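/-
Copyright: public-audit package `pub-balaban` (b2b-balaban), seat pv09-g5. Released under Apache 2.0 like Mathlib.
-/
import Literature.MathematicalPhysics.QuantumFieldTheory.Balaban1983to89.B6Lemma24Printed

/-!
# B6 Lemma 2.4 (2.128) with the printed constant 1/(12d²) ON THE TORUS T^(k) — the scope in which p. 249 uses it

Source under audit: T. Bałaban, *Propagators and renormalization transformations for lattice gauge theories.
II*, Commun. Math. Phys. **96** (1984) 223–250 [B6], Lemma 2.4 p. 245 and its use-site (2.152)–(2.153) p. 249;
(2.118) p. 243; (2.121) p. 244.  Quotations read by this seat from the ×2 page renders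
`run/shared/lean/pub/pub-balaban/b2b-balaban-ref1/pages/1984-cmp96-propagators-rt-II/…-p021-x2.png` (p. 243),
`…-p022-x2.png` (p. 244), `…-p023-x2.png` (p. 245), `…-p027-x2.png` (p. 249) (journal page = PDF page + 222), not
from an OCR layer.

CITATION HEADER (lean-in-tree rule).  Cell `pub-balaban`, unit `b2b-balaban-pv09-g5` (surge node prover #09,
gen 5; journal claim G-B6-L24-TORUS, self-assigned under the yield clause).  Siblings imported, none edited:
`…B6Lemma24Printed` (unit b06-g8: the per-face split `face_split`, the layer-restricted Poincaré inequality
`layer_sq_le`, the scalar assembly `assembly_core_one`, Lemma 2.4 as printed for Λ ⊂ Z^d) and through it the pv09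
lineage `B6TreeGaugePoincare` ((2.123), `ineq2123_rescaled`), `B6FaceInterpolation` ((2.124)), `B6AveragingBound`
((2.125)), `B6Lemma24Carrier` (`nIn`, `pIn`, `q1Term`), `B6Lemma24Assembly` (the face plaquettes `plaq`),
`B6Lemma24PrintedShape` (Q₁ verbatim `q1`, the B5 (1.8) average `q18`, (2.121) printed ⇒ tree form), `B6`
(`TreeData`, `Lemma24Printed`, `LowerBound2153`, `lowerBound2153_of_lemma24`).

## What is printed (verbatim)

* [B6] Lemma 2.4, p. 245: *"Lemma 2.4. Let a set Λ ⊂ Z^d be a sum of blocks, Λ = B(Λ′). We denote by Λ also a set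
  of bonds b such that at least one of the end-points b₋, b₊ belongs to Λ. Let B be a configuration defined on Λ
  and satisfying the condition (2.121): B(Γ_{y,x}) = 0 for x ∈ B(y), y ∈ Λ′. We put B = 0 outside Λ. Then the
  following inequality holds  L^{d−2} Σ_{c∈Λ′} |(Q₁B)(c)|² + Σ_p |(∂₁B)(p)|² ≥ (1/(12d²)) L^{−d−1} ‖B‖².  (2.128)"*
* [B6] p. 249, the use-site: *"Next let us consider the inequality (2.128) in Lemma 2.4 again. We will apply it in
  the following situation. Doing a k + 1 renormalization transformation we have to calculate an integral of the
  form  const ∫dB δ(QB) δ_{Ax}(B) e^{−½⟨B,Δ_kB⟩} F(B)  (1.152) [sic: (2.152)]  on the whole lattice T^{(k)}, or on a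
  subset Λ ⊂ T^{(k)}. Using (2.118) and (2.128) we get  ⟨B, Δ_kB⟩ ≥ (γ₀/(12d²)) L^{−d−1} ‖B‖²,  or
  Δ_k ≥ (γ₀/(12d²)) L^{−d−1}  (2.153)  on the subspace of B satisfying: QB = 0, B(Γ_{y,x}) = 0 for x ∈ B(y)."*
* [B6] (2.118), p. 243: *"γ₀‖∂₁B‖² ≤ ⟨B, Δ_jB⟩ ≤ γ₁‖∂₁B‖²."*
* [B6] (2.121), p. 244: *"B(b) = 0 for b ⊂ Γ_{y,x}, x ∈ B(y), y ∈ Λ′."* — the bond-wise (tree) form, which is the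
  hypothesis `hT` below; Lemma 2.4 (p. 245) and (2.153) (p. 249) restate it in the contour form *"B(Γ_{y,x}) = 0"*
  (hypothesis `hAx` of the `_contour` / `_printed` variants; contour ⇒ tree is `B6Lemma24PrintedShape.treeGauge_of_contour`).

## The scope gap this file closes (located, not a defect of the mathematics)

Lemma 2.4 is printed for a finite union of blocks Λ ⊂ Z^d with *"B = 0 outside Λ"*; p. 249 applies (2.128) *"on the
whole lattice T^{(k)}"*, a TORUS (B5 §A: T is a torus; `B6BondEliminationTorus`, `B6Sect5Torus`), where no
configuration vanishes "outside".  The tree certified (2.128) with the printed constant for the Z^d carriers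
(`B6Lemma24Printed.lemma24_one`, `lemma24Printed_carrier`, every d ≥ 2, L ≥ 1); the torus case is not an instance of
those theorems (their hypothesis `B = 0` off the bonds of Λ is false for a periodic B).  This file proves the torus
case with the SAME constant.

## What this file proves (all new declarations [folklore]: lattice bookkeeping; the analytic inputs are the
kernel theorems of the siblings)

The torus T = Z^d/(M₁Z × … × M_dZ) (periods M_i ≥ 1 with L ∣ M_i, so that the L-blocks tile T) is modelled by
M-PERIODIC configurations on the unit bonds of Z^d (`IsPeriodic`: B(⟨x + v, x + v + e_ν⟩) = B(⟨x, x + e_ν⟩) for v in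
the period lattice; `isPeriodic_of_generators`: it suffices that B(x + M_ie_i, ν) = B(x, ν)); torus sums are sums
over representatives: bonds ⟨x, x + e_ν⟩ and plaquettes (x; e_j, e_μ), j < μ, with x in the box Π_i [0, M_i)
(`bondsT`, `plaqT`, `normSqT` = ‖B‖², `d1SqT` = Σ_p|(∂₁B)(p)|²), coarse sites y ∈ LZ^d in the box (`coarseSites` =
Λ′ = T′), coarse bonds c = ⟨y, y + Le_μ⟩ (`faces`), Σ_{c∈Λ′}|(Q₁B)(c)|² with Q₁ verbatim from (2.125) (`q1SqT`,
`B6Lemma24PrintedShape.q1`).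

* §1–§3: periodicity, translation covariance of the block families (`sum_innerBonds_add`, `sum_innerPlaq_add`,
  `mem_treeBonds_add`), periodic invariance of the block sums and of the gauge (2.121) (`treeGauge_all`: the gauge
  on the blocks of the box is the gauge on every block of LZ^d), the reduction `wrap` to the box.
* §4: the torus bookkeeping replacing `B6Lemma24Assembly`'s "B = 0 outside Λ" bookkeeping — `crossing_cover_torus`
  (every torus bond is inside a block or crosses a face ⟨y, y + Le_μ⟩ from its last layer Δ′), `sum_blockN_plus`
  (Σ_c Σ_{b⊂B(c₊)} = d·N_in by the wrap bijection c ↦ c₊ of the torus coarse bonds), `faces_le_torus` (the face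
  plaquettes p(b), b ⊂ Δ′(c), are torus plaquettes outside every block, once each), `layersLast_le_torus` /
  `layersFirst_le_torus` (the tangential layer sums via `B6Lemma24Printed.layer_sq_le`, the first layers Δ″ ⊂ B(c₊)
  moved back into the box by periodicity).
* §5 **`lemma24_torus`**: for d ≥ 2, L ≥ 1, periods M_i ≥ 1 with L ∣ M_i, every M-periodic B in the gauge (2.121)
  on the blocks B(y), y ∈ T′:  (1/(12d²)) L^{−d−1} ‖B‖²_T ≤ L^{d−2} Σ_{c∈T′} |(Q₁B)(c)|² + Σ_{p⊂T} |(∂₁B)(p)|² — the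
  printed (2.128) on the whole torus, printed constant, by `B6Lemma24Printed.face_split` summed over the torus
  coarse bonds + `assembly_core_one` (layer constant 2/(L+1), `layerIneq_two_over`) + (2.123) (`ineq2123_rescaled`).
* §6 the typed printed nodes: `torusCarrier L M : B6.TreeData` and **`lemma24Printed_torus :
  B6.Lemma24Printed d L (fun i => torusCarrier L (M i))`**; **`lowerBound2153_torus`**: `B6.LowerBound2153` (2.153)
  for the torus carriers from (2.118) typed as the hypothesis `h2118` (exactly `B6.lowerBound2153_of_lemma24`);
  `lowerBound2153_torus_printed`: the sentence of p. 249 in printed shape — B periodic, *"B(Γ_{y,x}) = 0 for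
  x ∈ B(y)"* (contour form, every y ∈ T′), *"QB = 0"* ((Q₁B)(c) = 0 for every coarse bond c of T; by
  `q18_eq_q1_torus` the B5 (1.8) three-contour average agrees with Q₁ on the torus in this gauge), and a quadratic
  form with (2.118) γ₀ Σ_p|(∂₁B)(p)|² ≤ ⟨B, Δ_kB⟩ on periodic B ⟹ (γ₀/(12d²)) L^{−d−1}‖B‖² ≤ ⟨B, Δ_kB⟩.

## HONEST SCOPE

(i) What is certified is the INEQUALITY (2.128) with its printed constant on the whole torus (and hence the
bookkeeping (2.128) + (2.118) ⟹ (2.153) there); the proof is the cell's (b06-g8's mean/fluctuation route, not the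
printed derivation, whose sentence before (2.127) is refuted for L ≥ 10: `B6LayerTensor.layerIneq_one_iff`).
(ii) (2.118) = B5 (1.67) is NOT proved here: it enters `lowerBound2153_torus*` as the hypothesis `h2118` on an
arbitrary quadratic functional `form`/`formΔk`; identifying that functional with the Δ_k of B5 (1.66) on the torus
(`B5Bounds167Lattice`, `B5Prop11Plancherel.Tor`) is a separate dictionary, not asserted.  (iii) The torus is
modelled by periodic configurations on Z^d; for M_i ≥ 2 the representatives (base point in the box) are in
bijection with the bonds / plaquettes of T, for a degenerate period M_i = 1 (forced only if L = 1) the sums are the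
formal ones.  (iv) The case *"or on a subset Λ ⊂ T^{(k)}"* of p. 249 with Λ ≠ T wrapping around the torus is not
treated here (for Λ inside a fundamental box it is the Z^d Lemma, `B6Lemma24Printed.lemma24_one`).  No hypothesis of
any theorem below is a printed claim used as a fact.

Tags: (2.118), (2.121), (2.125), (2.128), (2.152), (2.153), Lemma 2.4, B6 p.243, B6 p.245, B6 p.249, torus.
-/

open Finset

namespace Literature.MathematicalPhysics.QuantumFieldTheory.Balaban1983to89.B6Lemma24Torus

open B6Elimination (block mem_block corner corner_apply corner_le mem_block_corner)
open B6BondElimination (unitVec unitVec_apply add_unitVec_apply add_smul_unitVec_apply sub_smul_unitVec_apply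
  treeBonds mem_treeBonds contour contour_subset_treeBonds)
open B6TreeGaugePoincare (Cfg curl innerBonds innerPlaq mem_innerBonds mem_innerPlaq ineq2123_rescaled)
open B6FaceInterpolation (lastLayer firstLayer bondsIn mem_lastLayer mem_firstLayer mem_bondsIn
  dir_ne_of_mem_bondsIn_lastLayer lastLayer_subset_block)
open B6Lemma24Carrier (nIn pIn coarseBonds q1Term eq_of_mem_block pairwiseDisjoint_innerBonds
  pairwiseDisjoint_innerPlaq)
open B6Lemma24Assembly (mem_coarseBonds plaq plaq_injOn plaq_not_mem_innerPlaq faces_pairwiseDisjoint curl_plaq_sq)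
open B6Lemma24PrintedShape (q1 q1_sq q18 contourSum q18_eq_q1_of_contours treeGauge_of_contour)
open B6Lemma24Kappa (LayerIneq)
open B6Lemma24Printed (layer_sq_le layerCoeff_nonneg bondsIn_lastLayer_subset bondsIn_firstLayer_subset face_split
  layerIneq_two_over assembly_core_one)
open B6LayerPoincarePair (kappa1 kappa1_pos)
open B6LayerUpperBound (kappa1_two)
open B6 (TreeData Lemma24Printed LowerBound2153 lowerBound2153_of_lemma24)

noncomputable section

variable {d : ℕ} {L : ℕ}

/-! ## §1  The torus as periodic configurations; the fundamental box -/

/-- The period lattice M₁Z × … × M_dZ ⊂ Z^d of the torus T = Z^d/(M₁Z × … × M_dZ). [folklore] -/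
def IsPeriod (M : Fin d → ℕ) (v : Fin d → ℤ) : Prop := ∀ i, (M i : ℤ) ∣ v i

/-- **A configuration on the torus T** = an M-periodic configuration on the unit bonds of Z^d:
B(⟨x + v, x + v + e_ν⟩) = B(⟨x, x + e_ν⟩) for every period v. [folklore] -/
def IsPeriodic (M : Fin d → ℕ) (B : Cfg d) : Prop :=
  ∀ (x v : Fin d → ℤ) (ν : Fin d), IsPeriod M v → B (x + v, ν) = B (x, ν)

/-- It suffices to check the generators: B(x + M_ie_i, ν) = B(x, ν) for every i. [folklore] -/
theorem isPeriodic_of_generators {M : Fin d → ℕ} {B : Cfg d}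
    (h : ∀ (x : Fin d → ℤ) (i ν : Fin d), B (x + (M i : ℤ) • unitVec i, ν) = B (x, ν)) : IsPeriodic M B := by
  classical
  -- integer multiples of one generator
  have h1 : ∀ (k : ℤ) (x : Fin d → ℤ) (i ν : Fin d), B (x + (k * (M i : ℤ)) • unitVec i, ν) = B (x, ν) := by
    intro k
    induction k using Int.induction_on with
    | zero => intro x i ν; rw [zero_mul, zero_smul, add_zero]
    | succ k ih =>
        intro x i ν
        rw [add_mul, one_mul, add_smul, ← add_assoc, h, ih]
    | pred k ih =>
        intro x i ν
        have h' := h (x + ((-(k : ℤ) - 1) * (M i : ℤ)) • unitVec i) i ν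
        rw [add_assoc, ← add_smul, show (-(k : ℤ) - 1) * (M i : ℤ) + (M i : ℤ) = -(k : ℤ) * (M i : ℤ) by ring,
          ih] at h'
        exact h'.symm
  intro x v ν hv
  -- v = Σ_i v_i e_i, one generator at a time
  have key : ∀ (s : Finset (Fin d)) (x : Fin d → ℤ), B (x + ∑ i ∈ s, v i • unitVec i, ν) = B (x, ν) := by
    intro s
    refine Finset.induction_on s (fun x => by rw [sum_empty, add_zero]) ?_
    intro i s hi ih x
    obtain ⟨m, hm⟩ := hv i
    rw [sum_insert hi, add_comm (v i • unitVec i), ← add_assoc, hm, mul_comm (M i : ℤ) m, h1, ih]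
  have hv' : ∑ i : Fin d, v i • unitVec i = v := by
    funext j
    rw [Finset.sum_apply]
    simp only [Pi.smul_apply, unitVec_apply, smul_eq_mul, mul_ite, mul_one, mul_zero, Finset.sum_ite_eq,
      Finset.mem_univ, if_true]
  have hk := key univ x
  rwa [hv'] at hk

/-- The box Π_i [0, M_i) ⊂ Z^d: one representative of every point of the torus. [folklore] -/
def pbox (M : Fin d → ℕ) : Finset (Fin d → ℤ) :=
  Fintype.piFinset fun i => Ico (0 : ℤ) (M i : ℤ)

/-- Membership in the box. [folklore] -/
theorem mem_pbox {M : Fin d → ℕ} {x : Fin d → ℤ} : x ∈ pbox M ↔ ∀ i, 0 ≤ x i ∧ x i < (M i : ℤ) := by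
  simp only [pbox, Fintype.mem_piFinset, mem_Ico]

/-- T′ = the coarse sites of the torus: the L-lattice points of the box (the blocks B(y), y ∈ T′, tile T when
L ∣ M_i). [folklore] -/
def coarseSites (L : ℕ) (M : Fin d → ℕ) : Finset (Fin d → ℤ) :=
  (pbox M).filter fun y => ∀ i, (L : ℤ) ∣ y i

/-- Membership in T′. [folklore] -/
theorem mem_coarseSites {M : Fin d → ℕ} {y : Fin d → ℤ} :
    y ∈ coarseSites L M ↔ y ∈ pbox M ∧ ∀ i, (L : ℤ) ∣ y i := mem_filter

/-- T′ ⊂ LZ^d (the hypothesis `hΛ` of the Z^d block lemmas). [folklore] -/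
theorem coarseSites_dvd {M : Fin d → ℕ} : ∀ y ∈ coarseSites L M, ∀ i, (L : ℤ) ∣ y i :=
  fun _ hy => (mem_coarseSites.1 hy).2

/-- The coarse bonds of the torus, c = ⟨y, y + Le_μ⟩ recorded (c₋, μ) = (y, μ), y ∈ T′ — the faces of the block
tiling (the index set *"c ∈ Λ′"* of (2.128) for Λ = T). [folklore] -/
def faces (L : ℕ) (M : Fin d → ℕ) : Finset ((Fin d → ℤ) × Fin d) :=
  coarseSites L M ×ˢ (univ : Finset (Fin d))

/-- Membership in the torus coarse bonds. [folklore] -/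
theorem mem_faces {M : Fin d → ℕ} {c : (Fin d → ℤ) × Fin d} : c ∈ faces L M ↔ c.1 ∈ coarseSites L M := by
  simp only [faces, mem_product, mem_univ, and_true]

/-- The torus coarse bonds are among the Z^d coarse bonds meeting T′ (`B6Lemma24Carrier.coarseBonds`). [folklore] -/
theorem faces_subset_coarseBonds {M : Fin d → ℕ} : faces L M ⊆ coarseBonds L (coarseSites L M) :=
  fun _ hc => mem_coarseBonds.2 (Or.inl (mem_faces.1 hc))

/-- c₊ = c₋ + Le_μ ∈ LZ^d for a torus coarse bond c. [folklore] -/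
theorem dvd_plus {M : Fin d → ℕ} {c : (Fin d → ℤ) × Fin d} (hc : c ∈ faces L M) (i : Fin d) :
    (L : ℤ) ∣ (c.1 + (L : ℤ) • unitVec c.2) i := by
  rw [add_smul_unitVec_apply]
  exact dvd_add (coarseSites_dvd _ (mem_faces.1 hc) i) (by split_ifs <;> simp)

/-- c₋ − Le_μ ∈ LZ^d for a torus coarse bond c. [folklore] -/
theorem dvd_minus {M : Fin d → ℕ} {c : (Fin d → ℤ) × Fin d} (hc : c ∈ faces L M) (i : Fin d) :
    (L : ℤ) ∣ (c.1 - (L : ℤ) • unitVec c.2) i := by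
  rw [sub_smul_unitVec_apply]
  exact dvd_sub (coarseSites_dvd _ (mem_faces.1 hc) i) (by split_ifs <;> simp)

/-- The bonds of the torus, once each: ⟨x, x + e_ν⟩ with x in the box. [folklore] -/
def bondsT (M : Fin d → ℕ) : Finset ((Fin d → ℤ) × Fin d) := pbox M ×ˢ (univ : Finset (Fin d))

/-- The plaquettes of the torus, once each: lowest corner x in the box, directions j < μ. [folklore] -/
def plaqT (M : Fin d → ℕ) : Finset ((Fin d → ℤ) × Fin d × Fin d) :=
  (pbox M ×ˢ ((univ : Finset (Fin d)) ×ˢ (univ : Finset (Fin d)))).filter fun p => p.2.1 < p.2.2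

/-- Membership in the torus bonds. [folklore] -/
theorem mem_bondsT {M : Fin d → ℕ} {b : (Fin d → ℤ) × Fin d} : b ∈ bondsT M ↔ b.1 ∈ pbox M := by
  simp only [bondsT, mem_product, mem_univ, and_true]

/-- Membership in the torus plaquettes. [folklore] -/
theorem mem_plaqT {M : Fin d → ℕ} {p : (Fin d → ℤ) × Fin d × Fin d} :
    p ∈ plaqT M ↔ p.1 ∈ pbox M ∧ p.2.1 < p.2.2 := by
  simp only [plaqT, mem_filter, mem_product, mem_univ, and_true]

/-- ‖B‖² on the torus: Σ over the bonds of T of |B(b)|². [cite: Balaban1984PropagatorsII, (2.128) p.245 / (2.153) p.249] -/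
def normSqT (M : Fin d → ℕ) (B : Cfg d) : ℝ := ∑ b ∈ bondsT M, B b ^ 2

/-- Σ_p |(∂₁B)(p)|² on the torus: Σ over the plaquettes of T. [cite: Balaban1984PropagatorsII, (2.128) p.245 / (2.118) p.243] -/
def d1SqT (M : Fin d → ℕ) (B : Cfg d) : ℝ := ∑ p ∈ plaqT M, curl B p.1 p.2.1 p.2.2 ^ 2

/-- Σ_{c∈T′} |(Q₁B)(c)|² on the torus, (Q₁B)(c) = Σ_{x∈B(c₋)} L^{−(d+1)} B([x, x + Le_μ]) verbatim from (2.125)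
(`B6Lemma24PrintedShape.q1`). [cite: Balaban1984PropagatorsII, (2.125) + (2.128) p.245] -/
def q1SqT (L : ℕ) (M : Fin d → ℕ) (B : Cfg d) : ℝ := ∑ c ∈ faces L M, q1 L B c ^ 2

/-- Σ_c |(Q₁B)(c)|² ≥ 0. [folklore] -/
theorem q1SqT_nonneg (M : Fin d → ℕ) (B : Cfg d) : 0 ≤ q1SqT L M B := sum_nonneg fun _ _ => sq_nonneg _

/-- A block B(y), y ∈ T′, lies in the box (L ∣ M_i). [folklore] -/
theorem block_subset_pbox {M : Fin d → ℕ} (hLM : ∀ i, L ∣ M i) {y : Fin d → ℤ} (hy : y ∈ coarseSites L M) :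
    block L y ⊆ pbox M := fun x hx => by
  obtain ⟨hyb, hyd⟩ := mem_coarseSites.1 hy
  refine mem_pbox.2 fun i => ?_
  obtain ⟨h1, h2⟩ := mem_block.1 hx i
  obtain ⟨h3, h4⟩ := mem_pbox.1 hyb i
  have hMi : (L : ℤ) ∣ (M i : ℤ) := Int.natCast_dvd_natCast.2 (hLM i)
  have h5 : (L : ℤ) ≤ (M i : ℤ) - y i := Int.le_of_dvd (by omega) (dvd_sub hMi (hyd i))
  exact ⟨by omega, by omega⟩

/-- The corner (B5 (1.6)) of a point of the box is a coarse site of the torus. [folklore] -/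
theorem corner_mem_coarseSites {M : Fin d → ℕ} (hL : 0 < L) {x : Fin d → ℤ} (hx : x ∈ pbox M) :
    corner L x ∈ coarseSites L M := by
  refine mem_coarseSites.2 ⟨mem_pbox.2 fun i => ⟨?_, ?_⟩, fun i => ⟨x i / (L : ℤ), corner_apply x i⟩⟩
  · rw [corner_apply]
    exact mul_nonneg (by positivity) (Int.ediv_nonneg (mem_pbox.1 hx i).1 (by positivity))
  · exact lt_of_le_of_lt (corner_le hL x i) (mem_pbox.1 hx i).2

/-! ## §2  Translation covariance of the block families -/

/-- x ∈ B(y + v) ⇔ x − v ∈ B(y). [folklore] -/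
theorem mem_block_add {y v x : Fin d → ℤ} : x ∈ block L (y + v) ↔ x - v ∈ block L y := by
  simp only [mem_block, Pi.add_apply, Pi.sub_apply]
  constructor
  · intro h i
    obtain ⟨h1, h2⟩ := h i
    exact ⟨by omega, by omega⟩
  · intro h i
    obtain ⟨h1, h2⟩ := h i
    exact ⟨by omega, by omega⟩

/-- Σ_{b⊂B(y + v)} f(b) = Σ_{b⊂B(y)} f(b + v). [folklore] -/
theorem sum_innerBonds_add (y v : Fin d → ℤ) (f : (Fin d → ℤ) × Fin d → ℝ) :
    ∑ b ∈ innerBonds L (y + v), f b = ∑ b ∈ innerBonds L y, f (b.1 + v, b.2) := by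
  refine sum_nbij' (fun b => (b.1 - v, b.2)) (fun b => (b.1 + v, b.2)) ?_ ?_ ?_ ?_ ?_
  · intro b hb
    obtain ⟨h1, h2⟩ := mem_innerBonds.1 hb
    simp only [Pi.add_apply] at h2
    refine mem_innerBonds.2 ⟨mem_block_add.1 h1, ?_⟩
    simp only [Pi.sub_apply]
    omega
  · intro b hb
    obtain ⟨h1, h2⟩ := mem_innerBonds.1 hb
    refine mem_innerBonds.2 ⟨mem_block_add.2 (by simpa using h1), ?_⟩
    simp only [Pi.add_apply]
    omega
  · intro b _; simp
  · intro b _; simp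
  · intro b _; simp

/-- Σ_{p⊂B(y + v)} g(p) = Σ_{p⊂B(y)} g(p + v). [folklore] -/
theorem sum_innerPlaq_add (y v : Fin d → ℤ) (g : (Fin d → ℤ) × Fin d × Fin d → ℝ) :
    ∑ p ∈ innerPlaq L (y + v), g p = ∑ p ∈ innerPlaq L y, g (p.1 + v, p.2) := by
  refine sum_nbij' (fun p => (p.1 - v, p.2)) (fun p => (p.1 + v, p.2)) ?_ ?_ ?_ ?_ ?_
  · intro p hp
    obtain ⟨h1, h2, h3, h4⟩ := mem_innerPlaq.1 hp
    simp only [Pi.add_apply] at h3 h4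
    refine mem_innerPlaq.2 ⟨mem_block_add.1 h1, h2, ?_, ?_⟩
    · simp only [Pi.sub_apply]; omega
    · simp only [Pi.sub_apply]; omega
  · intro p hp
    obtain ⟨h1, h2, h3, h4⟩ := mem_innerPlaq.1 hp
    refine mem_innerPlaq.2 ⟨mem_block_add.2 (by simpa using h1), h2, ?_, ?_⟩
    · simp only [Pi.add_apply]; omega
    · simp only [Pi.add_apply]; omega
  · intro p _; simp
  · intro p _; simp
  · intro p _; simp

/-- b ∈ Γ_{y+v} ⇔ b − v ∈ Γ_y (the tree (1.7) is translation covariant). [folklore] -/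
theorem mem_treeBonds_add {y v : Fin d → ℤ} {b : (Fin d → ℤ) × Fin d} :
    b ∈ treeBonds L (y + v) ↔ (b.1 - v, b.2) ∈ treeBonds L y := by
  rw [mem_treeBonds, mem_treeBonds, mem_block_add]
  simp only [Pi.add_apply, Pi.sub_apply]
  constructor
  · rintro ⟨h1, h2, h3⟩
    exact ⟨h1, fun i hi => by rw [h2 i hi]; ring, by omega⟩
  · rintro ⟨h1, h2, h3⟩
    exact ⟨h1, fun i hi => by have := h2 i hi; omega, by omega⟩

/-! ## §3  Periodic invariance; reduction to the box -/

section Periodic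

variable {M : Fin d → ℕ} {B : Cfg d}

/-- Periodicity backwards: B(x − v, ν) = B(x, ν). [folklore] -/
theorem IsPeriodic.sub_apply (hB : IsPeriodic M B) {v : Fin d → ℤ} (hv : IsPeriod M v) (x : Fin d → ℤ)
    (ν : Fin d) : B (x - v, ν) = B (x, ν) := by
  have h := hB (x - v) v ν hv
  rw [sub_add_cancel] at h
  exact h.symm

/-- (∂₁B) is periodic. [folklore] -/
theorem IsPeriodic.curl_add (hB : IsPeriodic M B) {v : Fin d → ℤ} (hv : IsPeriod M v) (z : Fin d → ℤ)
    (j μ : Fin d) : curl B (z + v) j μ = curl B z j μ := by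
  have hp : ∀ x ν, B (x + v, ν) = B (x, ν) := fun x ν => hB x v ν hv
  simp only [curl, add_right_comm z v, hp]

/-- Σ_{b⊂B(y)} |B(b)|² is a periodic function of y. [folklore] -/
theorem IsPeriodic.blockN_add (hB : IsPeriodic M B) {v : Fin d → ℤ} (hv : IsPeriod M v) (y : Fin d → ℤ) :
    ∑ b ∈ innerBonds L (y + v), B b ^ 2 = ∑ b ∈ innerBonds L y, B b ^ 2 := by
  rw [sum_innerBonds_add]
  exact sum_congr rfl fun b _ => by rw [hB b.1 v b.2 hv, Prod.mk.eta]

/-- Σ_{p⊂B(y)} |(∂₁B)(p)|² is a periodic function of y. [folklore] -/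
theorem IsPeriodic.blockP_add (hB : IsPeriodic M B) {v : Fin d → ℤ} (hv : IsPeriod M v) (y : Fin d → ℤ) :
    ∑ p ∈ innerPlaq L (y + v), curl B p.1 p.2.1 p.2.2 ^ 2 = ∑ p ∈ innerPlaq L y, curl B p.1 p.2.1 p.2.2 ^ 2 := by
  rw [sum_innerPlaq_add]
  exact sum_congr rfl fun p _ => by
    dsimp only
    rw [hB.curl_add hv]

/-- The gauge (2.121) on B(y) is the gauge on B(y + v) for a period v. [folklore] -/
theorem IsPeriodic.treeGauge_add (hB : IsPeriodic M B) {v : Fin d → ℤ} (hv : IsPeriod M v) {y : Fin d → ℤ}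
    (hT : ∀ b ∈ treeBonds L y, B b = 0) : ∀ b ∈ treeBonds L (y + v), B b = 0 := fun b hb => by
  have h := hT _ (mem_treeBonds_add.1 hb)
  rwa [hB.sub_apply hv, Prod.mk.eta] at h

/-- The representative of x in the box: x_i mod M_i. [folklore] -/
def wrap (M : Fin d → ℕ) (x : Fin d → ℤ) : Fin d → ℤ := fun i => x i % (M i : ℤ)

/-- wrap x lies in the box (M_i ≥ 1). [folklore] -/
theorem wrap_mem_pbox (hM : ∀ i, 0 < M i) (x : Fin d → ℤ) : wrap M x ∈ pbox M :=
  mem_pbox.2 fun i => by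
    have h0 : (0 : ℤ) < (M i : ℤ) := by exact_mod_cast hM i
    exact ⟨Int.emod_nonneg _ h0.ne', Int.emod_lt_of_pos _ h0⟩

/-- x − wrap x is a period. [folklore] -/
theorem isPeriod_sub_wrap (x : Fin d → ℤ) : IsPeriod M (x - wrap M x) := fun i =>
  ⟨x i / (M i : ℤ), by
    have h := Int.mul_ediv_add_emod (x i) (M i : ℤ)
    simp only [Pi.sub_apply, wrap]
    linarith⟩

/-- A point of the box is its own representative. [folklore] -/
theorem wrap_eq_self {x : Fin d → ℤ} (hx : x ∈ pbox M) : wrap M x = x :=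
  funext fun i => Int.emod_eq_of_lt (mem_pbox.1 hx i).1 (mem_pbox.1 hx i).2

/-- Congruent points have the same representative. [folklore] -/
theorem wrap_congr {x x' : Fin d → ℤ} (h : ∀ i, (M i : ℤ) ∣ x i - x' i) : wrap M x = wrap M x' :=
  funext fun i => ((Int.modEq_iff_dvd.2 (h i)).symm : Int.ModEq (M i : ℤ) (x i) (x' i))

/-- wrap (wrap z + w) = wrap (z + w). [folklore] -/
theorem wrap_wrap_add (z w : Fin d → ℤ) : wrap M (wrap M z + w) = wrap M (z + w) :=
  wrap_congr fun i => by
    obtain ⟨m, hm⟩ := isPeriod_sub_wrap (M := M) z i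
    simp only [Pi.sub_apply] at hm
    refine ⟨-m, ?_⟩
    simp only [Pi.add_apply]
    linarith

/-- The representative of an L-lattice point is a coarse site of the torus (L ∣ M_i). [folklore] -/
theorem wrap_mem_coarseSites (hM : ∀ i, 0 < M i) (hLM : ∀ i, L ∣ M i) {y : Fin d → ℤ}
    (hy : ∀ i, (L : ℤ) ∣ y i) : wrap M y ∈ coarseSites L M :=
  mem_coarseSites.2 ⟨wrap_mem_pbox hM y, fun i => by
    have e : y i % (M i : ℤ) = y i - (M i : ℤ) * (y i / (M i : ℤ)) := by
      have h := Int.mul_ediv_add_emod (y i) (M i : ℤ)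
      linarith
    show (L : ℤ) ∣ y i % (M i : ℤ)
    rw [e]
    exact dvd_sub (hy i) (dvd_mul_of_dvd_left (Int.natCast_dvd_natCast.2 (hLM i)) _)⟩

/-- **The gauge on the blocks of the box is the gauge on every block of LZ^d** (periodicity): δ_{Ax}(B) for
y ∈ T′ fixes (2.121) in every block of the periodic configuration. [folklore] -/
theorem treeGauge_all (hM : ∀ i, 0 < M i) (hLM : ∀ i, L ∣ M i) (hB : IsPeriodic M B)
    (hT : ∀ y ∈ coarseSites L M, ∀ b ∈ treeBonds L y, B b = 0) {y : Fin d → ℤ} (hy : ∀ i, (L : ℤ) ∣ y i) :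
    ∀ b ∈ treeBonds L y, B b = 0 := by
  have h := hB.treeGauge_add (isPeriod_sub_wrap y) (hT _ (wrap_mem_coarseSites hM hLM hy))
  rwa [add_sub_cancel] at h

/-- Σ_{c=(y,μ), y∈T′} g(c₋) = d · Σ_{y∈T′} g(y). [folklore] -/
theorem sum_faces_fst (g : (Fin d → ℤ) → ℝ) :
    ∑ c ∈ faces L M, g c.1 = (d : ℝ) * ∑ y ∈ coarseSites L M, g y := by
  rw [faces, sum_product, mul_sum]
  refine sum_congr rfl fun y _ => ?_
  simp only [sum_const, card_univ, Fintype.card_fin, nsmul_eq_mul]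

/-- **The wrap bijection c ↦ c₊ of the torus coarse bonds**: for a periodic function g of the coarse sites,
Σ_{c∈faces} g(c₊) = Σ_{c∈faces} g(c₋) (c₊ = c₋ + Le_μ reduced into the box permutes T′ for each μ). [folklore] -/
theorem sum_faces_shift (hM : ∀ i, 0 < M i) (hLM : ∀ i, L ∣ M i) (g : (Fin d → ℤ) → ℝ)
    (hg : ∀ y v, IsPeriod M v → g (y + v) = g y) :
    ∑ c ∈ faces L M, g (c.1 + (L : ℤ) • unitVec c.2) = ∑ c ∈ faces L M, g c.1 := by
  have hwrap : ∀ z, g (wrap M z) = g z := fun z => by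
    have h := hg (wrap M z) (z - wrap M z) (isPeriod_sub_wrap z)
    rw [add_sub_cancel] at h
    exact h.symm
  calc ∑ c ∈ faces L M, g (c.1 + (L : ℤ) • unitVec c.2)
      = ∑ c ∈ faces L M, g (wrap M (c.1 + (L : ℤ) • unitVec c.2)) :=
        sum_congr rfl fun c _ => (hwrap _).symm
    _ = ∑ c ∈ faces L M, g c.1 := by
        refine sum_nbij' (fun c => (wrap M (c.1 + (L : ℤ) • unitVec c.2), c.2))
          (fun c => (wrap M (c.1 - (L : ℤ) • unitVec c.2), c.2)) ?_ ?_ ?_ ?_ ?_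
        · exact fun c hc => mem_faces.2 (wrap_mem_coarseSites hM hLM (dvd_plus hc))
        · exact fun c hc => mem_faces.2 (wrap_mem_coarseSites hM hLM (dvd_minus hc))
        · intro c hc
          have h1 := (mem_coarseSites.1 (mem_faces.1 hc)).1
          refine Prod.ext ?_ rfl
          dsimp only
          rw [sub_eq_add_neg, wrap_wrap_add, ← sub_eq_add_neg, add_sub_cancel_right, wrap_eq_self h1]
        · intro c hc
          have h1 := (mem_coarseSites.1 (mem_faces.1 hc)).1
          refine Prod.ext ?_ rfl
          dsimp only
          rw [wrap_wrap_add, sub_add_cancel, wrap_eq_self h1]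
        · intro c _
          rfl

end Periodic

/-! ## §4  The torus bookkeeping: crossing bonds, block terms, face plaquettes, tangential layers -/

section Bookkeeping

variable {M : Fin d → ℕ}

/-- **Crossing cover on the torus**: every torus bond not inside a block B(y), y ∈ T′, is a crossing bond
⟨x, x + e_μ⟩ with x in the last layer Δ′ of the face c = ⟨y, y + Le_μ⟩, y = corner(x) ∈ T′; hence
‖B‖²_T − N_in ≤ Σ_{c∈faces} Σ_{x∈Δ′(c)} |B_μ(x)|². [folklore] -/
theorem crossing_cover_torus (hL : 0 < L) (hLM : ∀ i, L ∣ M i) (B : Cfg d) :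
    normSqT M B - nIn L (coarseSites L M) B ≤
      ∑ c ∈ faces L M, ∑ x ∈ lastLayer L c.1 c.2, B (x, c.2) ^ 2 := by
  classical
  have hΛ := coarseSites_dvd (L := L) (M := M)
  have hU : (coarseSites L M).biUnion (innerBonds L) ⊆ bondsT M := fun b hb => by
    obtain ⟨y, hy, hby⟩ := mem_biUnion.1 hb
    exact mem_bondsT.2 (block_subset_pbox hLM hy (mem_innerBonds.1 hby).1)
  have hn : nIn L (coarseSites L M) B = ∑ b ∈ (coarseSites L M).biUnion (innerBonds L), B b ^ 2 := by
    rw [nIn, sum_biUnion (pairwiseDisjoint_innerBonds hL hΛ)]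
  have hsd : normSqT M B - nIn L (coarseSites L M) B =
      ∑ b ∈ bondsT M \ (coarseSites L M).biUnion (innerBonds L), B b ^ 2 := by
    rw [hn, normSqT, ← sum_sdiff hU]
    ring
  have hdisj : (↑(faces L M) : Set ((Fin d → ℤ) × Fin d)).PairwiseDisjoint
      (fun c => (lastLayer L c.1 c.2).image fun x => (x, c.2)) := by
    intro c hc c' hc' hne
    rw [Function.onFun, disjoint_left]
    intro b hb hb'
    obtain ⟨x, hx, rfl⟩ := mem_image.1 hb
    obtain ⟨x', hx', hxx⟩ := mem_image.1 hb'
    simp only [Prod.mk.injEq] at hxx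
    obtain ⟨hx1, h2⟩ := hxx
    rw [hx1] at hx'
    exact hne (Prod.ext (eq_of_mem_block hL (hΛ _ (mem_faces.1 (mem_coe.1 hc)))
      (hΛ _ (mem_faces.1 (mem_coe.1 hc'))) (mem_lastLayer.1 hx).1 (mem_lastLayer.1 hx').1) h2.symm)
  have hcs : ∑ c ∈ faces L M, ∑ x ∈ lastLayer L c.1 c.2, B (x, c.2) ^ 2 =
      ∑ b ∈ (faces L M).biUnion (fun c => (lastLayer L c.1 c.2).image fun x => (x, c.2)), B b ^ 2 := by
    rw [sum_biUnion hdisj]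
    refine sum_congr rfl fun c _ => ?_
    rw [sum_image fun x _ x' _ h => by simpa using congr_arg Prod.fst h]
  rw [hsd, hcs]
  refine sum_le_sum_of_subset_of_nonneg (fun b hb => ?_) fun _ _ _ => sq_nonneg _
  obtain ⟨hbT, hbU⟩ := mem_sdiff.1 hb
  have hx : b.1 ∈ pbox M := mem_bondsT.1 hbT
  have hy : corner L b.1 ∈ coarseSites L M := corner_mem_coarseSites hL hx
  have hxy : b.1 ∈ block L (corner L b.1) := mem_block_corner hL b.1
  have hnn : b ∉ innerBonds L (corner L b.1) := fun h => hbU (mem_biUnion.2 ⟨_, hy, h⟩)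
  rw [mem_innerBonds] at hnn
  have hb1 := mem_block.1 hxy b.2
  have hco : b.1 b.2 = corner L b.1 b.2 + L - 1 := by
    by_contra hne
    exact hnn ⟨hxy, by omega⟩
  exact mem_biUnion.2 ⟨(corner L b.1, b.2), mem_faces.2 hy,
    mem_image.2 ⟨b.1, mem_lastLayer.2 ⟨hxy, hco⟩, rfl⟩⟩

/-- Σ_{c∈faces} Σ_{b⊂B(c₋)} |B(b)|² = d·N_in (each block of T′ is c₋ for exactly d coarse bonds). [folklore] -/
theorem sum_blockN_minus (B : Cfg d) :
    ∑ c ∈ faces L M, ∑ b ∈ innerBonds L c.1, B b ^ 2 = (d : ℝ) * nIn L (coarseSites L M) B :=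
  sum_faces_fst (fun y => ∑ b ∈ innerBonds L y, B b ^ 2)

/-- Σ_{c∈faces} Σ_{b⊂B(c₊)} |B(b)|² = d·N_in for a periodic B (the wrap bijection c ↦ c₊). [folklore] -/
theorem sum_blockN_plus (hM : ∀ i, 0 < M i) (hLM : ∀ i, L ∣ M i) {B : Cfg d} (hB : IsPeriodic M B) :
    ∑ c ∈ faces L M, ∑ b ∈ innerBonds L (c.1 + (L : ℤ) • unitVec c.2), B b ^ 2 =
      (d : ℝ) * nIn L (coarseSites L M) B := by
  rw [sum_faces_shift hM hLM (fun y => ∑ b ∈ innerBonds L y, B b ^ 2) (fun y v hv => hB.blockN_add hv y)]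
  exact sum_blockN_minus B

/-- **The face plaquettes are torus plaquettes outside every block, once each**:
Σ_{c∈faces} Σ_{b⊂Δ′(c)} |(∂₁B)(p(b))|² ≤ Σ_{p⊂T} |(∂₁B)(p)|² − P_in. [folklore] -/
theorem faces_le_torus (hL : 1 ≤ L) (hLM : ∀ i, L ∣ M i) (B : Cfg d) :
    ∑ c ∈ faces L M, ∑ b ∈ bondsIn (lastLayer L c.1 c.2), curl B b.1 b.2 c.2 ^ 2 ≤
      d1SqT M B - pIn L (coarseSites L M) B := by
  classical
  have hL0 : 0 < L := hL
  have hΛ := coarseSites_dvd (L := L) (M := M)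
  have hV : (coarseSites L M).biUnion (innerPlaq L) ⊆ plaqT M := fun p hp => by
    obtain ⟨y, hy, hpy⟩ := mem_biUnion.1 hp
    have h := mem_innerPlaq.1 hpy
    exact mem_plaqT.2 ⟨block_subset_pbox hLM hy h.1, h.2.1⟩
  have hp : pIn L (coarseSites L M) B =
      ∑ p ∈ (coarseSites L M).biUnion (innerPlaq L), curl B p.1 p.2.1 p.2.2 ^ 2 := by
    rw [pIn, sum_biUnion (pairwiseDisjoint_innerPlaq hL0 hΛ)]
  have hsd : d1SqT M B - pIn L (coarseSites L M) B =
      ∑ p ∈ plaqT M \ (coarseSites L M).biUnion (innerPlaq L), curl B p.1 p.2.1 p.2.2 ^ 2 := by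
    rw [hp, d1SqT, ← sum_sdiff hV]
    ring
  have hdisj : (↑(faces L M) : Set ((Fin d → ℤ) × Fin d)).PairwiseDisjoint
      (fun c => (bondsIn (lastLayer L c.1 c.2)).image (plaq c)) :=
    (faces_pairwiseDisjoint hL0 hΛ).subset (coe_subset.2 faces_subset_coarseBonds)
  have hcs : ∑ c ∈ faces L M, ∑ b ∈ bondsIn (lastLayer L c.1 c.2), curl B b.1 b.2 c.2 ^ 2 =
      ∑ p ∈ (faces L M).biUnion (fun c => (bondsIn (lastLayer L c.1 c.2)).image (plaq c)),
        curl B p.1 p.2.1 p.2.2 ^ 2 := by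
    rw [sum_biUnion hdisj]
    refine sum_congr rfl fun c _ => ?_
    rw [sum_image (plaq_injOn c)]
    exact sum_congr rfl fun b _ => (curl_plaq_sq B c b).symm
  rw [hsd, hcs]
  refine sum_le_sum_of_subset_of_nonneg (fun p hp' => ?_) fun _ _ _ => sq_nonneg _
  obtain ⟨c, hc, hpc⟩ := mem_biUnion.1 hp'
  obtain ⟨b, hb, rfl⟩ := mem_image.1 hpc
  have hcF := mem_faces.1 hc
  refine mem_sdiff.2 ⟨?_, fun h => ?_⟩
  · have hx : b.1 ∈ pbox M :=
      block_subset_pbox hLM hcF (lastLayer_subset_block c.1 c.2 (mem_bondsIn.1 hb).1)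
    have hne := dir_ne_of_mem_bondsIn_lastLayer hb
    unfold plaq
    split_ifs with h
    · exact mem_plaqT.2 ⟨hx, h⟩
    · exact mem_plaqT.2 ⟨hx, lt_of_le_of_ne (not_lt.1 h) (Ne.symm hne)⟩
  · obtain ⟨y', hy', h'⟩ := mem_biUnion.1 h
    exact plaq_not_mem_innerPlaq hL0 hΛ (faces_subset_coarseBonds hc) hb hy' h'

/-- **Σ_{c∈faces} Σ_{b⊂Δ′(c)} |B(b)|² ≤ (d−1)(L−1)L^{d−2}·d·P_in** ((2.121) in the blocks of T′, by
`B6Lemma24Printed.layer_sq_le`). [folklore] -/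
theorem layersLast_le_torus (hL : 1 ≤ L) {B : Cfg d}
    (hT : ∀ y ∈ coarseSites L M, ∀ b ∈ treeBonds L y, B b = 0) :
    ∑ c ∈ faces L M, ∑ b ∈ bondsIn (lastLayer L c.1 c.2), B b ^ 2 ≤
      ((d : ℝ) - 1) * ((L : ℝ) - 1) * (L : ℝ) ^ (d - 2) * ((d : ℝ) * pIn L (coarseSites L M) B) := by
  calc ∑ c ∈ faces L M, ∑ b ∈ bondsIn (lastLayer L c.1 c.2), B b ^ 2
      ≤ ∑ c ∈ faces L M, ((d : ℝ) - 1) * ((L : ℝ) - 1) * (L : ℝ) ^ (d - 2) *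
          ∑ p ∈ innerPlaq L c.1, curl B p.1 p.2.1 p.2.2 ^ 2 :=
        sum_le_sum fun c hc =>
          (sum_le_sum_of_subset_of_nonneg (bondsIn_lastLayer_subset c.1 c.2) fun _ _ _ => sq_nonneg _).trans
            (layer_sq_le hL c.1 c.2 _ B (hT c.1 (mem_faces.1 hc)))
    _ = ((d : ℝ) - 1) * ((L : ℝ) - 1) * (L : ℝ) ^ (d - 2) * ((d : ℝ) * pIn L (coarseSites L M) B) := by
        rw [← mul_sum, sum_faces_fst (fun y => ∑ p ∈ innerPlaq L y, curl B p.1 p.2.1 p.2.2 ^ 2)]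
        rfl

/-- **Σ_{c∈faces} Σ_{b⊂Δ″(c)} |B(b)|² ≤ (d−1)(L−1)L^{d−2}·d·P_in** for a periodic B: Δ″(c) ⊂ B(c₊) carries the gauge
by periodicity (`treeGauge_all`), and Σ_c P(c₊) = Σ_c P(c₋) by the wrap bijection. [folklore] -/
theorem layersFirst_le_torus (hL : 1 ≤ L) (hM : ∀ i, 0 < M i) (hLM : ∀ i, L ∣ M i) {B : Cfg d}
    (hB : IsPeriodic M B) (hT : ∀ y ∈ coarseSites L M, ∀ b ∈ treeBonds L y, B b = 0) :
    ∑ c ∈ faces L M, ∑ b ∈ bondsIn (firstLayer L c.1 c.2), B b ^ 2 ≤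
      ((d : ℝ) - 1) * ((L : ℝ) - 1) * (L : ℝ) ^ (d - 2) * ((d : ℝ) * pIn L (coarseSites L M) B) := by
  calc ∑ c ∈ faces L M, ∑ b ∈ bondsIn (firstLayer L c.1 c.2), B b ^ 2
      ≤ ∑ c ∈ faces L M, ((d : ℝ) - 1) * ((L : ℝ) - 1) * (L : ℝ) ^ (d - 2) *
          ∑ p ∈ innerPlaq L (c.1 + (L : ℤ) • unitVec c.2), curl B p.1 p.2.1 p.2.2 ^ 2 :=
        sum_le_sum fun c hc =>
          (sum_le_sum_of_subset_of_nonneg (bondsIn_firstLayer_subset c.1 c.2) fun _ _ _ => sq_nonneg _).trans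
            (layer_sq_le hL _ c.2 _ B (treeGauge_all hM hLM hB hT (dvd_plus hc)))
    _ = ((d : ℝ) - 1) * ((L : ℝ) - 1) * (L : ℝ) ^ (d - 2) * ((d : ℝ) * pIn L (coarseSites L M) B) := by
        rw [← mul_sum, sum_faces_shift hM hLM (fun y => ∑ p ∈ innerPlaq L y, curl B p.1 p.2.1 p.2.2 ^ 2)
          (fun y v hv => hB.blockP_add hv y),
          sum_faces_fst (fun y => ∑ p ∈ innerPlaq L y, curl B p.1 p.2.1 p.2.2 ^ 2)]
        rfl

/-- The face inequality `B6Lemma24Printed.face_split` summed over the torus coarse bonds. [folklore] -/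
theorem sum_face_split_torus (hd : 2 ≤ d) (hL : 1 ≤ L) {κ : ℝ} (hκ : 0 < κ) (hLI : LayerIneq d L κ)
    (M : Fin d → ℕ) (B : Cfg d) :
    ((L : ℝ)⁻¹) ^ (d + 1) * ∑ c ∈ faces L M, ∑ x ∈ lastLayer L c.1 c.2, B (x, c.2) ^ 2 ≤
      3 * q1SqT L M B +
      3 * ((L : ℝ)⁻¹) ^ d *
        (∑ c ∈ faces L M, ∑ b ∈ innerBonds L c.1, B b ^ 2 +
          ∑ c ∈ faces L M, ∑ b ∈ innerBonds L (c.1 + (L : ℤ) • unitVec c.2), B b ^ 2) +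
      3 / κ * ((L : ℝ)⁻¹) ^ d *
        (∑ c ∈ faces L M, ∑ b ∈ bondsIn (lastLayer L c.1 c.2), curl B b.1 b.2 c.2 ^ 2 +
          ∑ c ∈ faces L M, ∑ b ∈ bondsIn (lastLayer L c.1 c.2), B b ^ 2 +
          ∑ c ∈ faces L M, ∑ b ∈ bondsIn (firstLayer L c.1 c.2), B b ^ 2) := by
  have h := sum_le_sum fun c (_ : c ∈ faces L M) => face_split hd hL hκ hLI c.1 c.2 B
  refine le_trans (le_of_eq (mul_sum _ _ _)) (h.trans (le_of_eq ?_))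
  simp only [sum_add_distrib, ← mul_sum, Prod.mk.eta, q1SqT, q1_sq]

end Bookkeeping

/-! ## §5  Lemma 2.4 (2.128) with the printed constant on the whole torus -/

/-- **B6 Lemma 2.4 (2.128) ON THE TORUS T^(k), printed constant 1/(12d²)** (d ≥ 2, L ≥ 1, periods M_i ≥ 1 with
L ∣ M_i).  For every M-periodic configuration B in the gauge (2.121) on the blocks B(y), y ∈ T′:
(1/(12d²)) L^{−d−1} ‖B‖²_T ≤ L^{d−2} Σ_{c∈T′} |(Q₁B)(c)|² + Σ_{p⊂T} |(∂₁B)(p)|², Q₁ verbatim from (2.125) — the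
inequality p. 249 invokes *"on the whole lattice T^{(k)}"*. [cite: Balaban1984PropagatorsII, Lemma 2.4 (2.128) p.245; (2.153) p.249] -/
theorem lemma24_torus (hd : 2 ≤ d) (hL : 1 ≤ L) {M : Fin d → ℕ} (hM : ∀ i, 0 < M i) (hLM : ∀ i, L ∣ M i)
    (B : Cfg d) (hB : IsPeriodic M B) (hT : ∀ y ∈ coarseSites L M, ∀ b ∈ treeBonds L y, B b = 0) :
    1 / (12 * (d : ℝ) ^ 2) * (L : ℝ) ^ (-((d : ℝ) + 1)) * normSqT M B ≤
      (L : ℝ) ^ ((d : ℝ) - 2) * q1SqT L M B + d1SqT M B := by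
  have hL0 : 0 < L := hL
  have hLr : (0 : ℝ) < L := by exact_mod_cast hL0
  have hκ : 0 < kappa1 2 L := kappa1_pos (by norm_num) hL
  have hS := sum_face_split_torus hd hL hκ (layerIneq_two_over hd hL) M B
  have hk : 3 / kappa1 2 L = 3 * ((L : ℝ) + 1) / 2 := by
    rw [kappa1_two]
    field_simp
  rw [hk] at hS
  have hC := crossing_cover_torus hL0 hLM B
  have hN1 := (sum_blockN_minus (L := L) (M := M) B).le
  have hN2 := (sum_blockN_plus hM hLM hB).le
  have hF := faces_le_torus hL hLM B
  have hT1 := layersLast_le_torus hL hT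
  have hT2 := layersFirst_le_torus hL hM hLM hB hT
  have hII : ((L : ℝ)⁻¹) ^ d * nIn L (coarseSites L M) B ≤ (d : ℝ) * pIn L (coarseSites L M) B :=
    ineq2123_rescaled hL _ B hT
  have hF0 : (0 : ℝ) ≤ ∑ c ∈ faces L M, ∑ b ∈ bondsIn (lastLayer L c.1 c.2), curl B b.1 b.2 c.2 ^ 2 :=
    sum_nonneg fun _ _ => sum_nonneg fun _ _ => sq_nonneg _
  have core := assembly_core_one d L hd hL (normSqT M B) (nIn L (coarseSites L M) B)
    (pIn L (coarseSites L M) B) (d1SqT M B - pIn L (coarseSites L M) B) (q1SqT L M B) _ _ _ _ _ _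
    (sum_nonneg fun _ _ => sum_nonneg fun _ _ => sq_nonneg _)
    (sum_nonneg fun _ _ => sum_nonneg fun _ _ => sq_nonneg _) (hF0.trans hF) (q1SqT_nonneg M B)
    hC hS hN1 hN2 hF hT1 hT2 hII
  have e1 : (L : ℝ) ^ (-((d : ℝ) + 1)) = ((L : ℝ)⁻¹) ^ (d + 1) := by
    rw [Real.rpow_neg hLr.le, ← Nat.cast_succ, Real.rpow_natCast, inv_pow]
  have e2 : (L : ℝ) ^ ((d : ℝ) - 2) = (L : ℝ) ^ (d - 2) := by
    have h2 : ((d - 2 : ℕ) : ℝ) = (d : ℝ) - 2 := by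
      rw [Nat.cast_sub hd]
      norm_num
    rw [← h2, Real.rpow_natCast]
  have hd0 : (0 : ℝ) < 12 * (d : ℝ) ^ 2 := by
    have : (2 : ℝ) ≤ d := by exact_mod_cast hd
    positivity
  rw [e1, e2, show 1 / (12 * (d : ℝ) ^ 2) * ((L : ℝ)⁻¹) ^ (d + 1) * normSqT M B =
    (((L : ℝ)⁻¹) ^ (d + 1) * normSqT M B) / (12 * (d : ℝ) ^ 2) by ring, div_le_iff₀ hd0]
  linarith [core]

/-- The same with (2.121) in the contour form in which Lemma 2.4 (p. 245) and (2.153) (p. 249) restate it, *"B(Γ_{y,x}) = 0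
for x ∈ B(y), y ∈ Λ′"* (Λ′ = T′; contour ⇒ bond-wise form of p. 244 by `B6Lemma24PrintedShape.treeGauge_of_contour`).
[cite: Balaban1984PropagatorsII, Lemma 2.4 (2.128) p.245; (2.121) p.244] -/
theorem lemma24_torus_contour (hd : 2 ≤ d) (hL : 1 ≤ L) {M : Fin d → ℕ} (hM : ∀ i, 0 < M i)
    (hLM : ∀ i, L ∣ M i) (B : Cfg d) (hB : IsPeriodic M B)
    (hAx : ∀ y ∈ coarseSites L M, ∀ x ∈ block L y, contourSum L B y x = 0) :
    1 / (12 * (d : ℝ) ^ 2) * (L : ℝ) ^ (-((d : ℝ) + 1)) * normSqT M B ≤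
      (L : ℝ) ^ ((d : ℝ) - 2) * q1SqT L M B + d1SqT M B :=
  lemma24_torus hd hL hM hLM B hB fun y hy => treeGauge_of_contour (hAx y hy)

/-! ## §6  The typed printed nodes: `B6.Lemma24Printed` and (2.153) `B6.LowerBound2153` for the torus carriers -/

/-- **The torus carrier of Lemma 2.4** as `B6.TreeData`: configurations on the unit bonds of Z^d; TreeGauge B =
(B is M-periodic, i.e. a configuration on T) ∧ (2.121) on the blocks B(y), y ∈ T′; q1Sq = Σ_{c∈T′}|(Q₁B)(c)|²
(Q₁ verbatim, (2.125)); d1Sq = Σ_{p⊂T}|(∂₁B)(p)|²; normSq = ‖B‖²_T.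
[cite: Balaban1984PropagatorsII, Lemma 2.4 p.245 / (2.152)–(2.153) p.249; dictionary] -/
def torusCarrier (L : ℕ) (M : Fin d → ℕ) : TreeData where
  Cfg := Cfg d
  TreeGauge := fun B => IsPeriodic M B ∧ ∀ y ∈ coarseSites L M, ∀ b ∈ treeBonds L y, B b = 0
  q1Sq := q1SqT L M
  d1Sq := d1SqT M
  normSq := normSqT M

/-- **The typed printed node `B6.Lemma24Printed` for the torus carriers** (every d ≥ 2, L ≥ 1, every family of
tori with periods M_i ≥ 1, L ∣ M_i). [cite: Balaban1984PropagatorsII, Lemma 2.4 (2.128) p.245; (2.153) p.249] -/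
theorem lemma24Printed_torus {I : Type} (hd : 2 ≤ d) (hL : 1 ≤ L) (M : I → Fin d → ℕ)
    (hM : ∀ i j, 0 < M i j) (hLM : ∀ i j, L ∣ M i j) :
    Lemma24Printed d (L : ℝ) (fun i => torusCarrier L (M i)) := by
  intro i B hB
  exact lemma24_torus hd hL (hM i) (hLM i) B hB.1 hB.2

/-- **(2.153) on the torus, typed node `B6.LowerBound2153`**: for the torus carriers, any quadratic functionals
`formΔk` with (2.118) γ₀ Σ_{p⊂T}|(∂₁B)(p)|² ≤ formΔk B and any constraint `QZero` killing the Q₁-term give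
(γ₀/(12d²)) L^{−d−1} ‖B‖²_T ≤ formΔk B on {TreeGauge, QZero} — `B6.lowerBound2153_of_lemma24` fed with
`lemma24Printed_torus`.  (2.118) is the HYPOTHESIS `h2118`, not proved here. [cite: Balaban1984PropagatorsII, (2.153) p.249; (2.118) p.243] -/
theorem lowerBound2153_torus {I : Type} (hd : 2 ≤ d) (hL : 1 ≤ L) (M : I → Fin d → ℕ)
    (hM : ∀ i j, 0 < M i j) (hLM : ∀ i j, L ∣ M i j) {γ₀ : ℝ} (hγ : 0 ≤ γ₀)
    (formΔk : I → Cfg d → ℝ) (QZero : I → Cfg d → Prop)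
    (hQ : ∀ i B, QZero i B → q1SqT L (M i) B = 0)
    (h2118 : ∀ i B, γ₀ * d1SqT (M i) B ≤ formΔk i B) :
    LowerBound2153 d (L : ℝ) γ₀ (fun i => torusCarrier L (M i)) formΔk QZero :=
  lowerBound2153_of_lemma24 d (L : ℝ) γ₀ hγ (fun i => torusCarrier L (M i)) formΔk QZero
    (lemma24Printed_torus hd hL M hM hLM) hQ h2118

/-- In the gauge (2.121) on T′ the contour sums B(Γ_{y,x}) of EVERY block of LZ^d vanish (periodicity). [folklore] -/
theorem contourSum_eq_zero_torus {M : Fin d → ℕ} (hM : ∀ i, 0 < M i) (hLM : ∀ i, L ∣ M i) {B : Cfg d}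
    (hB : IsPeriodic M B) (hT : ∀ y ∈ coarseSites L M, ∀ b ∈ treeBonds L y, B b = 0) {y : Fin d → ℤ}
    (hy : ∀ i, (L : ℤ) ∣ y i) {x : Fin d → ℤ} (hx : x ∈ block L y) : contourSum L B y x = 0 :=
  sum_eq_zero fun b hb => treeGauge_all hM hLM hB hT hy b (contour_subset_treeBonds hx hb)

/-- **"Both points of view" agree on the torus**: for a periodic B in the gauge (2.121) on T′, the B5 (1.8)
three-contour average B_c (`q18`) equals (Q₁B)(c) of (2.125) (`q1`) at every coarse bond c of T — so *"QB = 0"* of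
p. 249 may be read either way ((1.8) as typed by the sibling `B6Lemma24PrintedShape.q18`).
[cite: Balaban1984PropagatorsI, (1.8), (1.11) p.19; Balaban1984PropagatorsII, (2.125) p.245] -/
theorem q18_eq_q1_torus {M : Fin d → ℕ} (hM : ∀ i, 0 < M i) (hLM : ∀ i, L ∣ M i) {B : Cfg d}
    (hB : IsPeriodic M B) (hT : ∀ y ∈ coarseSites L M, ∀ b ∈ treeBonds L y, B b = 0)
    {c : (Fin d → ℤ) × Fin d} (hc : c ∈ faces L M) : q18 L B c = q1 L B c :=
  q18_eq_q1_of_contours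
    (fun _ hx => contourSum_eq_zero_torus hM hLM hB hT (coarseSites_dvd _ (mem_faces.1 hc)) hx)
    (fun _ hx => contourSum_eq_zero_torus hM hLM hB hT (dvd_plus hc) hx)

/-- **(2.153) on the whole torus, printed shape.**  Let d ≥ 2, L ≥ 1, periods M_i ≥ 1 with L ∣ M_i; let `form` be
a functional with (2.118): γ₀ Σ_{p⊂T}|(∂₁B)(p)|² ≤ form B for every configuration B on T (γ₀ ≥ 0).  Then for every
configuration B on T (M-periodic) *"satisfying: QB = 0, B(Γ_{y,x}) = 0 for x ∈ B(y)"* ((Q₁B)(c) = 0 for every coarse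
bond c of T, Q₁ from (2.125) — equivalently the (1.8) average, `q18_eq_q1_torus` — and the contour form of (2.121)
for every y ∈ T′):  (γ₀/(12d²)) L^{−d−1} ‖B‖²_T ≤ form B. [cite: Balaban1984PropagatorsII, (2.153) p.249; (2.118) p.243] -/
theorem lowerBound2153_torus_printed (hd : 2 ≤ d) (hL : 1 ≤ L) {M : Fin d → ℕ} (hM : ∀ i, 0 < M i)
    (hLM : ∀ i, L ∣ M i) {γ₀ : ℝ} (hγ : 0 ≤ γ₀) (form : Cfg d → ℝ)
    (h2118 : ∀ B : Cfg d, IsPeriodic M B → γ₀ * d1SqT M B ≤ form B)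
    (B : Cfg d) (hB : IsPeriodic M B)
    (hAx : ∀ y ∈ coarseSites L M, ∀ x ∈ block L y, contourSum L B y x = 0)
    (hQ : ∀ c ∈ faces L M, q1 L B c = 0) :
    γ₀ / (12 * (d : ℝ) ^ 2) * (L : ℝ) ^ (-((d : ℝ) + 1)) * normSqT M B ≤ form B := by
  have h := lemma24_torus_contour hd hL hM hLM B hB hAx
  have hq : q1SqT L M B = 0 := sum_eq_zero fun c hc => by rw [hQ c hc]; ring
  rw [hq, mul_zero, zero_add] at h
  have h' := mul_le_mul_of_nonneg_left h hγ
  calc γ₀ / (12 * (d : ℝ) ^ 2) * (L : ℝ) ^ (-((d : ℝ) + 1)) * normSqT M B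
      = γ₀ * (1 / (12 * (d : ℝ) ^ 2) * (L : ℝ) ^ (-((d : ℝ) + 1)) * normSqT M B) := by ring
    _ ≤ γ₀ * d1SqT M B := h'
    _ ≤ form B := h2118 B hB

/-- The same with *"QB = 0"* read as the B5 (1.8) three-contour averages B_c = 0. [cite: Balaban1984PropagatorsII, (2.153) p.249; (2.118) p.243] -/
theorem lowerBound2153_torus_printed18 (hd : 2 ≤ d) (hL : 1 ≤ L) {M : Fin d → ℕ} (hM : ∀ i, 0 < M i)
    (hLM : ∀ i, L ∣ M i) {γ₀ : ℝ} (hγ : 0 ≤ γ₀) (form : Cfg d → ℝ)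
    (h2118 : ∀ B : Cfg d, IsPeriodic M B → γ₀ * d1SqT M B ≤ form B)
    (B : Cfg d) (hB : IsPeriodic M B)
    (hAx : ∀ y ∈ coarseSites L M, ∀ x ∈ block L y, contourSum L B y x = 0)
    (hQ : ∀ c ∈ faces L M, q18 L B c = 0) :
    γ₀ / (12 * (d : ℝ) ^ 2) * (L : ℝ) ^ (-((d : ℝ) + 1)) * normSqT M B ≤ form B :=
  lowerBound2153_torus_printed hd hL hM hLM hγ form h2118 B hB hAx fun c hc => by
    rw [← q18_eq_q1_torus hM hLM hB (fun y hy => treeGauge_of_contour (hAx y hy)) hc]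
    exact hQ c hc

end

end Literature.MathematicalPhysics.QuantumFieldTheory.Balaban1983to89.B6Lemma24Torus
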